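import Mathlib
import Summits.KontsevichZagierPeriods.Zeta5Search.TSOriginDataO54B1
import Summits.KontsevichZagierPeriods.Zeta5Search.TSOriginDataO54B2
import Summits.KontsevichZagierPeriods.Zeta5Search.TSOriginDataO54B3
import Summits.KontsevichZagierPeriods.Zeta5Search.TSOriginDataO54B4
import Summits.KontsevichZagierPeriods.Zeta5Search.TSOriginDataO54B5
import Summits.KontsevichZagierPeriods.Zeta5Search.TSOriginDataO54B6
import HarnessLib

/-!
# ζ(5) search — data of gen-2 g13's ORIGIN type-space window `M = 54` (`16 * n < 17 * p`,
    `18 * p ≤ 17 * n`) (part 8/8) (HONEST FRAMING: systematic search; no irrationality claim unless certified)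

Cell `pub-zeta5`, prover seat p3 generation 3 (generated by `code/gen/tsdata.py`).  Inventory of the window (all odd `p`, `n ≤ 150`,
    `code/gen/tswin.py`):
deep types `D54` (3), centre-free sub-deep types `S54` (4), odd-centre types `P54` (1); ALL type-level doubled orbit points lie on ONE line:
primitive direction `u54 = (38222630941052634846231007929863313589916160000, -57993101249962008127812740936483643927138591089)`,
    `Φ_u = u₁V − u₂W = c54 = 244175701002234614009310255431014105282728794809801842371/6290677286972128380019802112000000`; every deep orbit vector is `∥ u54`.  Each identity is PROVED by the computable
mirror `TypeEval.typeRho_eq_typeRhoC` + `decide +kernel`; `lineData54 : LineData u54 c54 D54 S54 P54` feeds `OriginWindows.deep_dir/lineVal_live`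
in the machine file `TSWindowO54.lean` (`ResidueLaw.RecTSClassesO54`, `RecWindowTSM54`).  Rational bookkeeping; nothing here bears on irrationality.
-/

noncomputable section

open Finset

namespace Summit.KontsevichZagierPeriods.Zeta5Search.OriginWindows

open Summit.KontsevichZagierPeriods.Zeta5Search.SecondOrder
open Summit.KontsevichZagierPeriods.Zeta5Search.LevelClass (typeW typeV)
open Summit.KontsevichZagierPeriods.Zeta5Search.ZeroWindows (deepPoint pairPoint)
open Summit.KontsevichZagierPeriods.Zeta5Search.TypeEval (typeRho_eq_typeRhoC)

variable {p : ℕ} [hp : Fact p.Prime]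

/-- **The line data of the `M = 54` window HOLD.** -/
theorem lineData54 : LineData u54 c54 D54 S54 P54 := by
  refine ⟨?_, ?_, ?_⟩
  · intro T hT
    simp only [D54, List.mem_cons, List.not_mem_nil, or_false] at hT
    rcases hT with rfl | rfl | rfl
    · exact ⟨d54_dir_1, d54_pt_1⟩
    · exact ⟨d54_dir_2, d54_pt_2⟩
    · exact ⟨d54_dir_3, d54_pt_3⟩
  · intro s hs
    simp only [S54, List.mem_cons, List.not_mem_nil, or_false] at hs
    rcases hs with rfl | rfl | rfl | rfl
    · exact s54_pt_1
    · exact s54_pt_2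
    · exact s54_pt_3
    · exact s54_pt_4
  · intro T hT
    simp only [P54, List.mem_cons, List.not_mem_nil, or_false] at hT
    rcases hT with rfl
    exact ⟨by decide, p54_pt_1⟩

omit hp in
/-- `u54` is primitive, so never `≡ 0 (mod p)`. -/
theorem u54_ne (hq : p.Prime) : ¬ ((p : ℤ) ∣ u54.1 ∧ (p : ℤ) ∣ u54.2) := by
  rintro ⟨h1, h2⟩
  have h := Int.dvd_gcd h1 h2
  rw [show Int.gcd u54.1 u54.2 = 1 by decide +kernel] at h
  exact hq.one_lt.ne' (Nat.dvd_one.1 h)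

end Summit.KontsevichZagierPeriods.Zeta5Search.OriginWindows

end
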